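import Summits.RiemannHypothesis.RiemannHypothesis.Theorems.WeilTwoPrimeDeflM80PDef
import Summits.RiemannHypothesis.RiemannHypothesis.Theorems.WeilTwoPrimeDeflM80PDataPE33
import Literature.NumberTheory.LFunctions.WeilBlockRowsR
import HarnessLib

/-!
# Even-sector deflated two-prime certificate M80P: the materialized even block agrees with `P_r + Σ μ ĉ ĉᵀ`, rows 30–39

`WeilCert.checkPmRowG` for certificate M80P (even block), by `decide +kernel`. Pure proof file; nothing is asserted.
-/

set_option linter.dupNamespace false

noncomputable section

namespace Summit.RiemannHypothesis.RiemannHypothesis.Theorems.EvenWinsBeyondArch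

open Literature.NumberTheory.LFunctions

set_option maxHeartbeats 0 in
/-- Row 30 of the materialized even block is row 30 of `P_r + Σ μ ĉ ĉᵀ` (certificate M80P). [folklore] -/
theorem checkPmRowG0_30_weilCertDeflM80P : weilCertDeflM80PBase.checkPmRowG weilCertDeflM80PP weilCertDeflM80PPmE 0 30 = true := by
  decide +kernel

set_option maxHeartbeats 0 in
/-- Row 31 of the materialized even block is row 31 of `P_r + Σ μ ĉ ĉᵀ` (certificate M80P). [folklore] -/
theorem checkPmRowG0_31_weilCertDeflM80P : weilCertDeflM80PBase.checkPmRowG weilCertDeflM80PP weilCertDeflM80PPmE 0 31 = true := by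
  decide +kernel

set_option maxHeartbeats 0 in
/-- Row 32 of the materialized even block is row 32 of `P_r + Σ μ ĉ ĉᵀ` (certificate M80P). [folklore] -/
theorem checkPmRowG0_32_weilCertDeflM80P : weilCertDeflM80PBase.checkPmRowG weilCertDeflM80PP weilCertDeflM80PPmE 0 32 = true := by
  decide +kernel

set_option maxHeartbeats 0 in
/-- Row 33 of the materialized even block is row 33 of `P_r + Σ μ ĉ ĉᵀ` (certificate M80P). [folklore] -/
theorem checkPmRowG0_33_weilCertDeflM80P : weilCertDeflM80PBase.checkPmRowG weilCertDeflM80PP weilCertDeflM80PPmE 0 33 = true := by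
  decide +kernel

set_option maxHeartbeats 0 in
/-- Row 34 of the materialized even block is row 34 of `P_r + Σ μ ĉ ĉᵀ` (certificate M80P). [folklore] -/
theorem checkPmRowG0_34_weilCertDeflM80P : weilCertDeflM80PBase.checkPmRowG weilCertDeflM80PP weilCertDeflM80PPmE 0 34 = true := by
  decide +kernel

set_option maxHeartbeats 0 in
/-- Row 35 of the materialized even block is row 35 of `P_r + Σ μ ĉ ĉᵀ` (certificate M80P). [folklore] -/
theorem checkPmRowG0_35_weilCertDeflM80P : weilCertDeflM80PBase.checkPmRowG weilCertDeflM80PP weilCertDeflM80PPmE 0 35 = true := by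
  decide +kernel

set_option maxHeartbeats 0 in
/-- Row 36 of the materialized even block is row 36 of `P_r + Σ μ ĉ ĉᵀ` (certificate M80P). [folklore] -/
theorem checkPmRowG0_36_weilCertDeflM80P : weilCertDeflM80PBase.checkPmRowG weilCertDeflM80PP weilCertDeflM80PPmE 0 36 = true := by
  decide +kernel

set_option maxHeartbeats 0 in
/-- Row 37 of the materialized even block is row 37 of `P_r + Σ μ ĉ ĉᵀ` (certificate M80P). [folklore] -/
theorem checkPmRowG0_37_weilCertDeflM80P : weilCertDeflM80PBase.checkPmRowG weilCertDeflM80PP weilCertDeflM80PPmE 0 37 = true := by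
  decide +kernel

set_option maxHeartbeats 0 in
/-- Row 38 of the materialized even block is row 38 of `P_r + Σ μ ĉ ĉᵀ` (certificate M80P). [folklore] -/
theorem checkPmRowG0_38_weilCertDeflM80P : weilCertDeflM80PBase.checkPmRowG weilCertDeflM80PP weilCertDeflM80PPmE 0 38 = true := by
  decide +kernel

set_option maxHeartbeats 0 in
/-- Row 39 of the materialized even block is row 39 of `P_r + Σ μ ĉ ĉᵀ` (certificate M80P). [folklore] -/
theorem checkPmRowG0_39_weilCertDeflM80P : weilCertDeflM80PBase.checkPmRowG weilCertDeflM80PP weilCertDeflM80PPmE 0 39 = true := by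
  decide +kernel


end Summit.RiemannHypothesis.RiemannHypothesis.Theorems.EvenWinsBeyondArch
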